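import Mathlib
import Summits.Schanuel.Schanuel.Theorems.RigidCoreMinimalCounterexampleInAclNoFullLine
import Summits.Schanuel.Schanuel.Theorems.RigidCoreMinimalCounterexampleInAclCosetLineDensityZero
import Summits.Schanuel.Schanuel.Theorems.RigidCoreMinimalCounterexampleInAclLineFamilyProjFibreFinite

/-!
# S7b in the CURVE CASE — crux stmt-Schanuel-0969 `RigidCore.MinimalCounterexampleInAcl`

Line `kernel-arithmetic-selection` (lead prover-line-stmt-Schanuel-0969-c13-0), registered stub `stub_corankGeTwo_noFullLine_curveCase`
(`--supports stmt-Schanuel-0969`): statement (P2) of the obstruction note of S7b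
(`Cruxes/MinimalCounterexampleInAcl/Lines/kernel_arithmetic_selection_S7b_obstruction.md` §4), the terminal step of the non-free
descent.

Let `x` be a first failure of rank `n` with `r ≤ n − 2` log coordinates, `μ ≠ 0` an integer direction supported on the log indices, and
`xm` a family of mates of `x` ON THE `μ`-LINE indexed by a set `J ⊆ ℤ` of POSITIVE UPPER BANACH DENSITY.  If over some field of
constants `ℚ(ev)` the slice points `P_j = (xm j, e^{xm j})`, `j ∈ J`, are mutually generic with `P_{j₀}` and `P_{j₀}` is algebraic over
`ℚ[ev, v]`, `v = xm j₀ k₀` the moving coordinate (`μ_{k₀} = d ≠ 0`) — the CURVE CASE — we reach a contradiction: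

1. `stub_lineFamily_projFibreFinite` (Theorems/…LineFamilyProjFibreFinite): a pure coordinate `x_i` with `j ↦ e^{xm j i}` finite-to-one;
2. `exists_sliceCurve` (Theorems/…NoFullLineSlice) on `(v, x_i, e^v, e^{x_i})`: a Zariski closed `W ⊆ ℂ² × ℂ²` of dimension `< 2`
   containing the projected slice points `q_j = (xm j k₀, xm j i)`, which are independent exponential points of `W` on the coset
   `x_{k₀} + 2πiℤ` (positions `jd`), fibre-finite by 1;
3. `stub_cosetLine_densityZero_corankOne` (P1, Theorems/…CosetLineDensityZero): the positions of the hits have upper Banach density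
   zero — but `d·J` has upper Banach density `≥ δ/|d| > 0` (a window `[a, a+N)` with `≥ δN` elements of `J` maps into a window of
   length `|d|N`).

References: status note `Cruxes/MinimalCounterexampleInAcl/Lines/kernel_arithmetic_selection.md` §Addendum c13.
-/

noncomputable section

set_option linter.dupNamespace false

open Complex Set

namespace Summit.Schanuel.Schanuel.Cruxes.MinimalCounterexampleInAcl.KernelArithmeticSelection

open Literature.NumberTheory.Transcendental

/-- **Windows scale**: multiplication by `d ≠ 0` maps the integer window `[a, a + N)` into a window of length `|d|·N`. [folklore] -/
theorem exists_window_mul (a : ℤ) (N : ℕ) {d : ℤ} (hd : d ≠ 0) :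
    ∃ A : ℤ, ∀ j : ℤ, a ≤ j → j < a + N → A ≤ j * d ∧ j * d < A + ((d.natAbs * N : ℕ) : ℤ) := by
  rcases lt_or_gt_of_ne hd with hneg | hpos
  · refine ⟨(a + N) * d + 1, fun j hj1 hj2 => ?_⟩
    push_cast
    rw [abs_of_neg hneg]
    constructor <;> nlinarith
  · refine ⟨a * d, fun j hj1 hj2 => ?_⟩
    push_cast
    rw [abs_of_pos hpos]
    constructor <;> nlinarith

/-- **A set of positive upper Banach density is infinite.** [folklore] -/
theorem infinite_of_upperDensity_pos {J : Set ℤ} {δ : ℝ} (hδ : 0 < δ)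
    (hdens : ∀ N₀ : ℕ, ∃ N : ℕ, N₀ ≤ N ∧ ∃ a : ℤ,
      δ * (N : ℝ) ≤ (Set.ncard {j : ℤ | j ∈ Finset.Ico a (a + (N : ℤ)) ∧ j ∈ J} : ℝ)) : J.Infinite := by
  intro hJfin
  obtain ⟨N₀, hN₀⟩ := exists_nat_gt ((J.ncard : ℝ) / δ)
  obtain ⟨N, hN, a, ha⟩ := hdens N₀
  have hsub : {j : ℤ | j ∈ Finset.Ico a (a + (N : ℤ)) ∧ j ∈ J} ⊆ J := fun j hj => hj.2
  have h1 : (Set.ncard {j : ℤ | j ∈ Finset.Ico a (a + (N : ℤ)) ∧ j ∈ J} : ℝ) ≤ J.ncard := by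
    exact_mod_cast Set.ncard_le_ncard hsub hJfin
  rw [div_lt_iff₀ hδ] at hN₀
  have hN' : (N₀ : ℝ) ≤ N := by exact_mod_cast hN
  nlinarith

/-- **Stub P2 — S7b IN THE CURVE CASE (PROVED).**  A family of mates on the `μ`-line over a set of positive upper Banach density whose
slice points are, over a field of constants `ℚ(ev)`, algebraic over `ℚ[ev, xm j₀ k₀]` and mutually generic, is contradictory
(projected fibre finiteness + slice curve + density zero of coset hits; see the module docstring). [folklore] -/
theorem stub_corankGeTwo_noFullLine_curveCase : ∀ (n r : ℕ), 3 ≤ n → r + 2 ≤ n → ∀ (x : Fin n → ℂ), x ∈ Summit.Schanuel.Schanuel.Cruxes.MinimalCounterexampleInAcl.KernelArithmeticSelection.firstFailures n → (∀ i : Fin n, (i : ℕ) < r → IsAlgebraic ℚ (Complex.exp (x i))) → (∀ M : Fin n → ℤ, (∃ i : Fin n, r ≤ (i : ℕ) ∧ M i ≠ 0) → Transcendental ℚ (Complex.exp (∑ i, (M i : ℂ) * x i))) → ∀ μ : Fin n → ℤ, (∀ i : Fin n, r ≤ (i : ℕ) → μ i = 0) → μ ≠ 0 → ∀ (J : Set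 ℤ) (xm : ℤ → Fin n → ℂ), (∀ j ∈ J, xm j ∈ Summit.Schanuel.Schanuel.Cruxes.MinimalCounterexampleInAcl.KernelArithmeticSelection.locusMates x ∧ ∀ i : Fin n, (i : ℕ) < r → xm j i = x i + 2 * ↑Real.pi * Complex.I * ((j • μ) i : ℂ)) → (∃ δ : ℝ, 0 < δ ∧ ∀ N₀ : ℕ, ∃ N : ℕ, N₀ ≤ N ∧ ∃ a : ℤ, δ * (N : ℝ) ≤ (Set.ncard {j : ℤ | j ∈ Finset.Ico a (a + (N : ℤ)) ∧ j ∈ J} : ℝ)) → (∃ (ι : Type) (ev : ι → ℂ) (j₀ : ℤ) (k₀ : Fin n), j₀ ∈ J ∧ μ k₀ ≠ 0 ∧ (∀ z ∈ Set.range (xm j₀) ∪ Set.range (Complex.exp ∘ xm j₀), IsAlgebraic ↥(Algebra.adjoin ℚ (Set.range ev ∪ {xm j₀ k₀})) z) ∧ ∀ j ∈ J, ∀ H : MvPolynomial (ι ⊕ (Fin n ⊕ Fin n)) ℚ, MvPolynomial.aeval (Sum.elim ev (Sum.elim (xm j₀) (Complex.exp ∘ xm j₀))) H = 0 ↔ MvPolynomial.aeval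 (Sum.elim ev (Sum.elim (xm j) (Complex.exp ∘ xm j))) H = 0) → False := by
  rintro n r h3 hrn x hx hlog hpure μ hμsupp hμ J xm hfam ⟨δ₀, hδ₀, hdens⟩ hcurve
  have hJinf : J.Infinite := infinite_of_upperDensity_pos hδ₀ hdens
  obtain ⟨i, hir, hfib⟩ :=
    stub_lineFamily_projFibreFinite n r h3 hrn x hx hlog hpure μ hμsupp hμ J xm hfam hJinf hcurve
  obtain ⟨ι, ev, j₀, k₀, -, hk₀, hH1, hH2⟩ := hcurve
  classical
  have h2πi : (2 * ↑Real.pi * I : ℂ) ≠ 0 := by simp [Real.pi_ne_zero, I_ne_zero]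
  -- ### the frame of the line
  set d : ℤ := μ k₀ with hd
  have hd0 : d ≠ 0 := hk₀
  have hk₀r : (k₀ : ℕ) < r := by
    by_contra h
    exact hk₀ (hμsupp k₀ (not_lt.1 h))
  have hki : k₀ ≠ i := fun h => (not_le.2 hk₀r) (h ▸ hir)
  have hxmk : ∀ j ∈ J, xm j k₀ = x k₀ + 2 * ↑Real.pi * I * ((j * d : ℤ) : ℂ) := by
    intro j hj
    rw [(hfam j hj).2 k₀ hk₀r, Pi.smul_apply, smul_eq_mul]
  -- ### the projected slice points `q_j = (xm j k₀, xm j i)` and the slice curve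
  set q : ℤ → Fin 2 → ℂ := fun j => ![xm j k₀, xm j i] with hq
  set P : Fin 2 ⊕ Fin 2 → ℂ := Sum.elim (q j₀) (cexp ∘ q j₀) with hP
  obtain ⟨W, hWcl, hWdim, hWmem⟩ : ∃ W : Set (Fin 2 ⊕ Fin 2 → ℂ), IsZariskiClosed ℂ W ∧ zariskiDim ℂ W < 2 ∧
      ∀ P' : Fin 2 ⊕ Fin 2 → ℂ, (∀ H : MvPolynomial (ι ⊕ (Fin 2 ⊕ Fin 2)) ℚ,
        MvPolynomial.aeval (Sum.elim ev P) H = 0 → MvPolynomial.aeval (Sum.elim ev P') H = 0) → P' ∈ W := by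
    refine exists_sliceCurve ev P (xm j₀ k₀) fun s => ?_
    rcases s with s | s <;> fin_cases s
    · exact hH1 _ (Or.inl ⟨k₀, rfl⟩)
    · exact hH1 _ (Or.inl ⟨i, rfl⟩)
    · exact hH1 _ (Or.inr ⟨k₀, rfl⟩)
    · exact hH1 _ (Or.inr ⟨i, rfl⟩)
  -- transfer of relations to the projection
  have key : ∀ (j : ℤ) (H : MvPolynomial (ι ⊕ (Fin 2 ⊕ Fin 2)) ℚ),
      MvPolynomial.aeval (Sum.elim ev (Sum.elim (q j) (cexp ∘ q j))) H =
        MvPolynomial.aeval (Sum.elim ev (Sum.elim (xm j) (cexp ∘ xm j)))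
          (MvPolynomial.rename (Sum.map id (Sum.map ![k₀, i] ![k₀, i])) H) := by
    intro j H
    have hfun : (Sum.elim ev (Sum.elim (xm j) (cexp ∘ xm j))) ∘ Sum.map id (Sum.map ![k₀, i] ![k₀, i]) =
        Sum.elim ev (Sum.elim (q j) (cexp ∘ q j)) := by
      funext s
      rcases s with s | (s | s)
      · rfl
      · fin_cases s <;> simp [hq]
      · fin_cases s <;> simp [hq]
    rw [MvPolynomial.aeval_rename, hfun]
  set Q : Set (Fin 2 → ℂ) := q '' J with hQ
  have hQW : Q ⊆ indepExpPoints W := by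
    rintro _ ⟨j, hj, rfl⟩
    refine ⟨?_, ?_⟩
    · have e2 : q j = xm j ∘ ![k₀, i] := by
        funext s; fin_cases s <;> simp [hq]
      rw [e2]
      refine (hfam j hj).1.1.comp _ fun a b hab => ?_
      fin_cases a <;> fin_cases b
      · rfl
      · exact absurd hab hki
      · exact absurd hab.symm hki
      · rfl
    · refine hWmem _ fun H hH => ?_
      rw [key] at hH ⊢
      exact (hH2 j hj _).1 hH
  -- ### fibre finiteness of the projected family (step 1)
  have hQfib : ∀ ω : Fin 2 → ℂ, Set.Finite {p : Fin 2 → ℂ | p ∈ Q ∧ cexp ∘ p = ω} := by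
    intro ω
    refine ((hfib (ω 1)).image q).subset ?_
    rintro _ ⟨⟨j, hj, rfl⟩, hω⟩
    refine ⟨j, ⟨hj, ?_⟩, rfl⟩
    have h1 := congrFun hω 1
    simpa [hq] using h1
  -- ### density zero of the coset hits (P1) against positive density of `d·J`
  set D : ℕ := d.natAbs with hD
  have hDpos : 0 < D := Int.natAbs_pos.2 hd0
  have hD1 : (1 : ℝ) ≤ D := by exact_mod_cast hDpos
  set δ : ℝ := δ₀ / (2 * D) with hδ
  have hδpos : 0 < δ := by positivity
  obtain ⟨N₀, hN₀⟩ := stub_cosetLine_densityZero_corankOne W Q (x k₀) hWcl hWdim hQW hQfib δ hδpos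
  obtain ⟨N, hN, a, ha⟩ := hdens (max N₀ 1)
  have hN1 : 1 ≤ N := le_of_max_le_right hN
  have hNN₀ : N₀ ≤ D * N := (le_of_max_le_left hN).trans (Nat.le_mul_of_pos_left N hDpos)
  obtain ⟨A, hA⟩ := exists_window_mul a N hd0
  have hhit := hN₀ (D * N) hNN₀ A
  -- the two counted sets as finsets
  set SJ : Finset ℤ := (Finset.Ico a (a + (N : ℤ))).filter (fun j : ℤ => j ∈ J) with hSJ
  set HF : Finset ℤ := (Finset.Ico A (A + ((D * N : ℕ) : ℤ))).filter
    (fun m : ℤ => ∃ p ∈ Q, p 0 = x k₀ + 2 * ↑Real.pi * I * (m : ℂ)) with hHF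
  have hSJset : {j : ℤ | j ∈ Finset.Ico a (a + (N : ℤ)) ∧ j ∈ J} = ↑SJ := by
    ext j; simp only [hSJ, Finset.coe_filter, Set.mem_setOf_eq]
  have hHFset : {m : ℤ | m ∈ Finset.Ico A (A + ((D * N : ℕ) : ℤ)) ∧ ∃ p ∈ Q, p 0 = x k₀ + 2 * ↑Real.pi * I * (m : ℂ)} =
      ↑HF := by
    ext m; simp only [hHF, Finset.coe_filter, Set.mem_setOf_eq]
  rw [hSJset, Set.ncard_coe_finset] at ha
  rw [hHFset, Set.ncard_coe_finset] at hhit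
  -- `j ↦ jd` maps `SJ` injectively into `HF`
  have hcard : SJ.card ≤ HF.card := by
    refine Finset.card_le_card_of_injOn (fun j : ℤ => j * d) (fun j hj => ?_) ?_
    · obtain ⟨hjI, hjJ⟩ := Finset.mem_filter.1 (Finset.mem_coe.1 hj)
      rw [Finset.mem_Ico] at hjI
      obtain ⟨hA1, hA2⟩ := hA j hjI.1 hjI.2
      refine Finset.mem_coe.2 (Finset.mem_filter.2 ⟨Finset.mem_Ico.2 ⟨hA1, ?_⟩, q j, ⟨j, hjJ, rfl⟩, ?_⟩)
      · simpa [hD] using hA2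
      · show xm j k₀ = _
        rw [hxmk j hjJ]
    · intro j _ j' _ h
      exact mul_right_cancel₀ hd0 h
  have hcard' : (SJ.card : ℝ) ≤ HF.card := by exact_mod_cast hcard
  have hδD : δ * ((D * N : ℕ) : ℝ) = δ₀ * N / 2 := by
    rw [hδ]; push_cast
    field_simp
  rw [hδD] at hhit
  have hpos : 0 < δ₀ * N := mul_pos hδ₀ (by exact_mod_cast hN1)
  linarith

end Summit.Schanuel.Schanuel.Cruxes.MinimalCounterexampleInAcl.KernelArithmeticSelection

end
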